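import Summits.BirchSwinnertonDyer.BirchSwinnertonDyer.Theorems.GenusKolyvaginAtTwoMinimalTwinBSDTwoAnalyticTwin
import HarnessLib

/-!
# Route `GenusKolyvaginAtTwo` — THE RANK-ONE HALF OF THE LEAF MINUS ITS TORSION CELL IS ONE KOLYVAGIN STATEMENT AT 2
# (LEAD bsd-line-gk2-p1 g31; census of the new residual R′ `RankOneNonMinimalResidualAtTwo` of director-bsd (687)/(695)/(697))

Seat `bsd-line-gk2-p1` g31 (LEAD lineage, cell `bsd-f1-sign2`).  THEOREMS ONLY, standard axioms, no `sorry`; every theorem is CONDITIONAL on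
its displayed hypotheses (the route's PRINT named facts, Friedberg–Hoffstein, WALL row 1, and the research statement KEX⁰ below).
**BSD is NOT proved by this file; U₂, R′, the WALL rows and KEX⁰ stay OPEN; nothing is closed.**

OBSERVATION.  gk2-p2 g27's LINE 23 v2.4 engine `…TwinSwap.AnalyticTwin` (p-file `…MinimalTwinBSDTwoAnalyticTwin`) derives U₂ («non-CM, `r_an = 1`,
`#Sel₂(W) = 2` ⟹ BSD₂») from WALL row 1 + Friedberg–Hoffstein + KEX′ + PRINT, and uses the `2`-Selmer MINIMALITY `#Sel₂(W) = 2` at exactly ONE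
place: to get `W(ℚ)[2] = 0` (`rank_eq_one_and_sha_primary_eq_zero_of_natCard_selmerGroup_eq_two`, middle component).  Everything else runs on
`r_an(W) = 1` alone (Gross–Zagier–Kolyvagin gives the rank, Gross–Zagier the Heegner point, Milne the descent of the BSD quotient, with `Ш(W)[2^∞]`
of ANY size carried inside `#Ш(W_K)[2^∞]`).  Hence the same engine runs for EVERY non-CM rank-one curve WITHOUT RATIONAL 2-TORSION:

* §1–§3: g27's §1–§3 with the binder `#Sel₂(W) = 2` replaced by `W(ℚ)[2] = 0` (proofs VERBATIM otherwise);
* §4 ★ `bsdp_of_wall_of_friedbergHoffstein_of_kex0_of_facts`: **BSD₂ for every non-CM globally minimal `W` with `r_an = 1` and `W(ℚ)[2] = 0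
  ⟸ WALL row 1 + FH + KEX⁰ + PRINT**, where KEX⁰ is KEX′ (the `2`-primary Gross–Zagier index relation `#Ш(W_K)[2^∞]·4^{ord₂ c + ord₂ C(W)} = 4^{M₀}`
  at every odd Heegner frame with `2` split, any minimal twin) with `#Sel₂(W) = 2` replaced by `W(ℚ)[2] = 0`;
* §5 ★ `kex0_of_rankOneNoTwoTorsionBSDTwo_of_wall_of_facts`: KEX⁰ is LOSSLESS (⟸ that BSD₂ statement + WALL row 1 + PRINT);
* census corollaries BY NAME (U₂ ⟸ … + KEX⁰; KEX⁰ ⟹ KEX′; the residual's two cells) live in the sequel `…AnalyticTwinNoTwoTorsionCensus`: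
  U₂'s research stub and the Ш-cell of the residual R′ (rank one, `W(ℚ)[2] = 0`, `Ш(W)[2] ≠ 0`) are the SAME statement KEX⁰ = DIV⁰ ∧ NDIV⁰
  (LINE 23's two halves typed without the Selmer clause).  What KEX⁰ does NOT reach is the TORSION cell of R′
  (rank one, `W(ℚ)[2] ≠ 0`: reducible `ρ̄_{W,2}`, the exact `2`-depth of `P(1)` is not an index, and no Heegner–Kolyvagin engine at `2` exists in the tree
  or in print for non-CM rank one — Cai–Li–Zhai 2020 is analytic rank `0`, Coates–Li–Tian–Zhai 2015's rank-one theorem is the CM curve `X₀(49)`).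

So, for the pen / J / wall-lead (census currency, not a registry proposal): modulo WALL row 1 + PRINT, `U₂ ∧ R′ ⟺ KEX⁰ ∧ R′_tors` with
R′_tors := «non-CM, `r_an = 1`, `W(ℚ)[2] ≠ 0` ⟹ BSD₂».  BSD is NOT proved by any of this.

References: [GrossZagier1986] V.§2 (2.2); [GrossLMS1991] §2 (2.3), §5 Prop. 5.3; [McCallumLMS1991] §5 Lemma 5.1; [FriedbergHoffstein1995] main theorem;
[Milne1972ArithmeticAV] §1 Thm. 1; [BCDTJAMS2001] Thm. A; [SilvermanAEC2009] VIII.8 Cor. 8.3, X.4.2; [Miller2011LMS] Def. 1.1.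
-/

set_option autoImplicit false
set_option linter.dupNamespace false -- `Summit.<P>.<Sub>` repeats `BirchSwinnertonDyer` (D-0017)

noncomputable section

open scoped Classical

open WeierstrassCurve NumberField Literature.NumberTheory.EllipticCurves
  Literature.NumberTheory.EllipticCurves.ModularForms
  Literature.NumberTheory.EllipticCurves.Rank1Residual
  Literature.NumberTheory.EllipticCurves.Rank1Residual.Typed
  Literature.NumberTheory.EllipticCurves.KrizLi2019
  Summit.BirchSwinnertonDyer.Rank1Residual
  Summit.BirchSwinnertonDyer.Rank1Residual.AdditivePotMult
  Summit.BirchSwinnertonDyer.BirchSwinnertonDyer.Rank1Residual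
  Summit.BirchSwinnertonDyer.BirchSwinnertonDyer.Theorems.CMExactDescent
  Summit.BirchSwinnertonDyer.BirchSwinnertonDyer.Theorems.GenusExact.TwinSwap
  Summit.BirchSwinnertonDyer.BirchSwinnertonDyer.Theorems.GenusExact.TwinSwap.IdentityDoor
  Summit.BirchSwinnertonDyer.BirchSwinnertonDyer.Theorems.GenusExact.TwinSwap.AnalyticTwin

open Summit.BirchSwinnertonDyer.BirchSwinnertonDyer.Theorems.GenusExact.TwinSwap.Ledger.Line25
  (exists_kolyvaginHeegnerData_one_of_nonempty_modularParametrizationData not_isOfFinAddOrder_derivedPoint_one_of_rankOne_of_lValue_ne_zero)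
open Summit.BirchSwinnertonDyer.BirchSwinnertonDyer.Theorems.KolyvaginAtTwo (exists_exactTwoDepth)
open Literature.NumberTheory.QuadraticFields.Quadratic (ncard_primesOver_two_eq_two_iff)

namespace Summit.BirchSwinnertonDyer.BirchSwinnertonDyer.Theorems.GenusExact.TwinSwap.AnalyticTwin.NoTwoTorsion

/-! ## §1 Gross–Zagier over `K` on the swapped frame, rank one WITHOUT rational 2-torsion: `ord₂ #Ш_an(W_K) = 2M₀ − 2 ord₂ c − 2 ord₂ C(W)` -/

/-- **g27's `AnalyticTwin.padicValRat_shaAnOverC_of_swappedPair_anyTwin` with `#Sel₂(W) = 2` replaced by `W(ℚ)[2] = 0`.**  `W/ℚ` globally minimal,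
`r_an(W) = 1`, no rational `2`-torsion (any `Sel₂(W)`, any `Ш(W)`, any sign, any `C(W)`); `K` imaginary quadratic, `d_K` odd `≠ −3`, Heegner for `N_W`; any
datum (`c ≠ 0`); `d₁` conductor-`1` with `P(1)` of infinite order and `2^{M₀} ∥ P(1)`; `Wd` ANY globally minimal model of `W^{(d_K)}`; PRINT `hGZ`, `hGZK`,
`hmod`.  Then `r_an(Wd) = 0`, `r_an(W_K) = 1`, `Ш(W_K)` finite and `#Ш_an(W_K) = q` with **`ord₂ q = 2M₀ − 2 ord₂ c − 2 ord₂ C(W)`**.  Proof VERBATIM g27's,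
minus its one use of the Selmer count.  CONDITIONAL on the named facts; closes nothing.
[cite: GrossZagier1986, V.§2 (2.2)] [cite: McCallumLMS1991, §5 Lemma 5.1] [cite: GrossLMS1991, §2 (2.3)] -/
theorem padicValRat_shaAnOverC_of_swappedPair_noTwoTorsion
    (W : WeierstrassCurve ℚ) [W.IsElliptic] [W.IsGloballyMinimal] [NeZero (W.conductorNorm ℤ)]
    (K : Type) [Field K] [NumberField K]
    (hGZ : gross_zagier (W.conductorNorm ℤ) W K) (hGZK : rank_eq_analyticRank_of_analyticRank_le_one) (hmod : hasEntireLFunction_rat)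
    (hr : W.analyticRank = 1) (hT2 : ∀ P : W.toAffine.Point, 2 • P = 0 → P = 0)
    (hK : IsImaginaryQuadratic K) (hodd : Odd (NumberField.discr K)) (h3 : NumberField.discr K ≠ -3)
    (hH : SatisfiesHeegnerHypothesis (W.conductorNorm ℤ) K)
    (Dt : ModularParametrizationData W (W.conductorNorm ℤ)) (hc0 : Dt.c ≠ 0) (β : ℤ) (ι : K →+* ℂ)
    (d₁ : KolyvaginHeegnerData Dt β ι 1) (hy : ¬ IsOfFinAddOrder d₁.derivedPoint) {M₀ : ℕ}
    (hdiv : ∃ Q : (W.baseChange (ringClassField K ι 1)).toAffine.Point, ((2 ^ M₀ : ℕ) : ℤ) • Q = d₁.derivedPoint)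
    (hndiv : ¬ ∃ Q : (W.baseChange (ringClassField K ι 1)).toAffine.Point, ((2 ^ (M₀ + 1) : ℕ) : ℤ) • Q = d₁.derivedPoint)
    (Wd : WeierstrassCurve ℚ) [Wd.IsElliptic] [Wd.IsGloballyMinimal]
    (Cd : VariableChange ℚ) (hCd : Cd • W.quadraticTwist (NumberField.discr K : ℚ) = Wd) :
    Wd.analyticRank = 0 ∧ (W.baseChange K).analyticRank = 1 ∧ Finite (W.baseChange K).sha ∧
      ∃ q : ℚ, shaAnOverC (W.baseChange K) = (q : ℂ) ∧
        padicValRat 2 q = 2 * (M₀ : ℤ) - 2 * (padicValInt 2 Dt.c : ℤ) - 2 * (padicValNat 2 W.tamagawaProduct : ℤ) := by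
  haveI : Fact (Nat.Prime 2) := ⟨Nat.prime_two⟩
  haveI hEK : (W.baseChange K).IsElliptic := isElliptic_baseChange' W K
  have h2 : Module.finrank ℚ K = 2 := hK.1
  have hD0 : (NumberField.discr K : ℚ) ≠ 0 := by exact_mod_cast NumberField.discr_ne_zero K
  haveI hEt : (W.quadraticTwist (NumberField.discr K : ℚ)).IsElliptic := W.isElliptic_quadraticTwist hD0
  obtain ⟨-, hDlt⟩ := discr_emod_four_and_lt_of_odd hK hodd h3
  have hw2 : Units.torsionOrder K = 2 :=
    Literature.NumberTheory.QuadraticFields.Quadratic.torsionOrder_eq_two_of_discr_lt_neg_four h2 hDlt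
  -- the Heegner point `P₀ ∈ E(K)` below `P(1)`
  obtain ⟨P₀, Hd, hP₀, hP₀K⟩ := exists_heegnerPoint_map_eq_derivedPoint_one hK hH d₁
  have hPinf : ¬ IsOfFinAddOrder P₀ := by
    intro hfin
    apply hy
    rw [← hP₀K]
    exact (WeierstrassCurve.Affine.Point.map (W' := W)
      (algebraMap K (ringClassField K ι 1)).toRatAlgHom).isOfFinAddOrder hfin
  haveI : Module.Finite ℤ (W.baseChange K).toAffine.Point := (W.baseChange K).module_finite_point_holds
  -- `E(ℚ)[2] = 0` (HYPOTHESIS, in place of the Selmer count), hence `E(K[1])[2^M] = 0` and `E(K)[2] = 0`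
  have hT2' : ∀ P : W.toAffine.Point, 2 • P = 0 → P = 0 := fun P hP ↦ by convert hT2 P (by convert hP)
  have htor1 : ∀ (M : ℕ) (R : (W.baseChange (ringClassField K ι 1)).toAffine.Point),
      ((2 ^ M : ℕ) : ℤ) • R = 0 → R = 0 :=
    fun M R hR ↦ eq_zero_of_two_pow_smul_eq_zero_ringClassField_of_noTwoTorsion W hK hodd hH hT2' ι M R hR
  have hiv : ∀ x : (W.baseChange K).toAffine.Point, 2 • x = 0 → x = 0 := fun x hx ↦
    forall_two_zsmul_baseChange_eq_zero_of_heegner W K hK hodd hH hT2' x (by rw [← natCast_zsmul] at hx; exact_mod_cast hx)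
  -- analytic ranks
  have hrt : (W.quadraticTwist (NumberField.discr K : ℚ)).analyticRank = 0 :=
    analyticRank_twist_eq_zero_of_rankOne W K hGZ hmod hK hH hr ⟨Dt, Hd, ι, hP₀⟩ hPinf
  have hrd : Wd.analyticRank = 0 := by rw [← hCd, analyticRank_smul, hrt]
  have hrK : (W.baseChange K).analyticRank = 1 :=
    (P2.analyticRank_baseChange_eq_one_iff W K hmod h2).mpr (Or.inl ⟨hr, hrt⟩)
  -- Gross–Zagier over `K`
  obtain ⟨hrkK, hShaK, -, hshaC⟩ := shaAnOverC_baseChange_eq_of_heegner W K Dt Hd ι P₀ hGZ hGZK hmod hK hH hP₀ hc0 hrK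
  haveI hfinK : Finite (W.baseChange K).sha := hShaK
  -- `ord₂ [E(K) : ℤP₀] = M₀`
  have hdivK : ∃ Q : (W.baseChange K).toAffine.Point, ((2 ^ M₀ : ℕ) : ℤ) • Q = P₀ :=
    (X11b.Three.Koly.pDiv_one_iff_exists_zsmul_eq hK d₁ P₀ hP₀K 2 M₀ (htor1 M₀)).mp hdiv
  have hndivK : ¬ ∃ Q : (W.baseChange K).toAffine.Point, ((2 ^ (M₀ + 1) : ℕ) : ℤ) • Q = P₀ :=
    fun h ↦ hndiv ((X11b.Three.Koly.pDiv_one_iff_exists_zsmul_eq hK d₁ P₀ hP₀K 2 (M₀ + 1) (htor1 (M₀ + 1))).mpr h)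
  haveI : Finite (AddCommGroup.torsion (W.baseChange K).toAffine.Point) :=
    WeierstrassCurve.finite_torsion_point (W := W.baseChange K)
  obtain ⟨cc, Q, hcQ, hcker⟩ := X11b.RankOne.exists_coord_of_mordellWeilRank_eq_one (W.baseChange K) hrkK
  have hidx : padicValNat 2 (AddSubgroup.zmultiples P₀).index = M₀ :=
    X11b.Three.Koly.padicValNat_index_zmultiples_eq_of_divisibility (p := 2) cc Q hcQ hcker hiv P₀ hdivK hndivK
  set I := (AddSubgroup.zmultiples P₀).index with hI_def
  have hI0 : I ≠ 0 := fun hI ↦ by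
    have hh := P2.torsionOrder_sq_mul_canonicalHeight_eq_index_sq_mul_regulator (W.baseChange K) hrkK P₀ hPinf
    rw [← hI_def, hI, Nat.cast_zero, zero_pow two_ne_zero, zero_mul, mul_eq_zero, pow_eq_zero_iff two_ne_zero,
      Nat.cast_eq_zero] at hh
    exact hh.elim (W.baseChange K).torsionOrder_pos_holds.ne'
      (fun h0 ↦ hPinf ((Affine.Point.canonicalHeight_eq_zero_iff_holds P₀).mp h0))
  set q : ℚ := 4 * (I : ℚ) ^ 2 /
      ((Dt.c : ℚ) ^ 2 * (Units.torsionOrder K : ℚ) ^ 2 * ((W.tamagawaProduct : ℚ) ^ 2)) with hq_def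
  have hcQ0 : (Dt.c : ℚ) ≠ 0 := by exact_mod_cast hc0
  have hcW0 : (W.tamagawaProduct : ℚ) ≠ 0 := by exact_mod_cast W.tamagawaProduct_pos_holds.ne'
  have hIQ0 : (I : ℚ) ≠ 0 := by exact_mod_cast hI0
  have hq' : q = ((I : ℚ) / ((Dt.c : ℚ) * (W.tamagawaProduct : ℚ))) ^ 2 := by
    rw [hq_def, hw2]
    push_cast
    field_simp
    ring
  have hvc : padicValRat 2 (Dt.c : ℚ) = padicValInt 2 Dt.c := padicValRat.of_int
  have hval : padicValRat 2 q = 2 * (M₀ : ℤ) - 2 * (padicValInt 2 Dt.c : ℤ) - 2 * (padicValNat 2 W.tamagawaProduct : ℤ) := by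
    rw [hq', padicValRat.pow, padicValRat.div hIQ0 (mul_ne_zero hcQ0 hcW0),
      padicValRat.mul hcQ0 hcW0, hvc, padicValRat.of_nat, padicValRat.of_nat, hidx]
    push_cast
    ring
  exact ⟨hrd, hrK, hShaK, q, hshaC, hval⟩

/-! ## §2 The swapped exact descent at Ш-depth, rank one without rational 2-torsion, ANY twin -/

/-- **g27's `swappedPairDescentAtTwo_shaDepth_anyTwin_of_facts` with `#Sel₂(W) = 2` replaced by `W(ℚ)[2] = 0`**: for a non-torsion frame of a rank-one
`W` without rational `2`-torsion, the exactness-shaped input `#Ш(W_K)[2^∞] · 2^{2(ord₂ c + ord₂ C(W))} = 2^{2M₀}` and ANY globally minimal model `Wd` of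
`W^{(d_K)}` give **`BSD₂(Wd) → BSD₂(W)`** (any `Ш(W)[2]`).  CONDITIONAL on the four named facts; closes nothing.
[cite: GrossZagier1986, V.§2 (pp. 310–312)] [cite: GrossLMS1991, §2 (2.3), §5 Prop. 5.3] [cite: Milne1972ArithmeticAV, §1 Thm. 1]
[cite: McCallumLMS1991, §5 Lemma 5.1] [cite: Miller2011LMS, Def. 1.1] -/
theorem swappedPairDescentAtTwo_shaDepth_noTwoTorsion_of_facts
    (hGZ : ∀ (N : ℕ) [NeZero N] (W : WeierstrassCurve ℚ) (K : Type) [Field K] [NumberField K],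
      gross_zagier N W K)
    (hGZK : rank_eq_analyticRank_of_analyticRank_le_one) (hmod : hasEntireLFunction_rat)
    (hMilneC : Milne1972.bsdQuotient_baseChange_quadratic_anyModel) :
    ∀ (W : WeierstrassCurve ℚ) [W.IsElliptic] [W.IsGloballyMinimal] [NeZero (W.conductorNorm ℤ)],
      W.analyticRank = 1 → (∀ P : W.toAffine.Point, 2 • P = 0 → P = 0) →
      ∀ (K : Type) [Field K] [NumberField K], IsImaginaryQuadratic K → Odd (NumberField.discr K) →
      NumberField.discr K ≠ -3 → SatisfiesHeegnerHypothesis (W.conductorNorm ℤ) K →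
      ∀ (Dt : ModularParametrizationData W (W.conductorNorm ℤ)), Dt.c ≠ 0 →
      ∀ (β : ℤ) (ι : K →+* ℂ) (d₁ : KolyvaginHeegnerData Dt β ι 1), ¬ IsOfFinAddOrder d₁.derivedPoint →
      ∀ (M₀ : ℕ),
        (∃ Q : (W.baseChange (ringClassField K ι 1)).toAffine.Point, ((2 ^ M₀ : ℕ) : ℤ) • Q = d₁.derivedPoint) →
        (¬ ∃ Q : (W.baseChange (ringClassField K ι 1)).toAffine.Point, ((2 ^ (M₀ + 1) : ℕ) : ℤ) • Q = d₁.derivedPoint) →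
        Nat.card (AddCommGroup.primaryComponent (W.baseChange K).sha 2) *
            2 ^ (2 * (padicValInt 2 Dt.c + padicValNat 2 W.tamagawaProduct)) = 2 ^ (2 * M₀) →
      ∀ (Wd : WeierstrassCurve ℚ) [Wd.IsElliptic] [Wd.IsGloballyMinimal],
        (∃ C : WeierstrassCurve.VariableChange ℚ, C • W.quadraticTwist (NumberField.discr K : ℚ) = Wd) →
        BSDp Wd 2 → BSDp W 2 := by
  intro W _ _ _ hr hT2 K _ _ hK hodd h3 hH Dt hc0 β ι d₁ hy M₀ hdiv hndiv hsha Wd _ _ hWd hBd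
  haveI : Fact (Nat.Prime 2) := ⟨Nat.prime_two⟩
  haveI hEK : (W.baseChange K).IsElliptic := isElliptic_baseChange' W K
  have h2 : Module.finrank ℚ K = 2 := hK.1
  obtain ⟨Cd, hCd⟩ := hWd
  obtain ⟨hrd, -, hShaK, q, hshaC, hval⟩ := padicValRat_shaAnOverC_of_swappedPair_noTwoTorsion W K (hGZ _ W K) hGZK hmod
    hr hT2 hK hodd h3 hH Dt hc0 β ι d₁ hy hdiv hndiv Wd Cd hCd
  haveI : Finite (W.baseChange K).sha := hShaK
  have hcard_pos : 0 < Nat.card (AddCommGroup.primaryComponent (W.baseChange K).sha 2) := Nat.card_pos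
  have hshaV : (padicValNat 2 (W.baseChange K).shaOrder : ℤ) =
      2 * (M₀ : ℤ) - 2 * (padicValInt 2 Dt.c : ℤ) - 2 * (padicValNat 2 W.tamagawaProduct : ℤ) := by
    rw [X11b.Three.Koly.padicValNat_shaOrder_eq (W.baseChange K) 2]
    have h := congrArg (padicValNat 2) hsha
    rw [padicValNat.mul hcard_pos.ne' (pow_ne_zero _ two_ne_zero), padicValNat.prime_pow, padicValNat.prime_pow] at h
    omega
  have hKin : MissingPPartOverCAt (W.baseChange K) 2 := ⟨q, hshaC, by rw [hval, hshaV]⟩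
  exact bsdp_of_pPartOverC_baseChange W 2 K Wd hGZK hmod hMilneC hr.le h2 ⟨Cd, hCd⟩
    (by rw [hrd]; exact zero_le_one) hKin hBd

/-! ## §3 Losslessness on one frame, rank one without rational 2-torsion, ANY twin -/

/-- **g27's `natCard_sha_mul_eq_of_bsdp_anyTwin` with `#Sel₂(W) = 2` replaced by `W(ℚ)[2] = 0`**: on the frame of §1, `BSD₂(W) ∧ BSD₂(Wd)` + PRINT force
`#Ш(W_K)[2^∞] · 2^{2(ord₂ c + ord₂ C(W))} = 2^{2M₀}` for the exact depth `M₀` of `P(1)`.  CONDITIONAL; proves nothing about BSD.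
[cite: GrossZagier1986, V.§2 (2.2)] [cite: Milne1972ArithmeticAV, §1 Thm. 1] [cite: McCallumLMS1991, §5 Lemma 5.1] [cite: Miller2011LMS, Def. 1.1] -/
theorem natCard_sha_mul_eq_of_bsdp_noTwoTorsion
    (W : WeierstrassCurve ℚ) [W.IsElliptic] [W.IsGloballyMinimal] [NeZero (W.conductorNorm ℤ)]
    (K : Type) [Field K] [NumberField K]
    (hGZ : gross_zagier (W.conductorNorm ℤ) W K) (hGZK : rank_eq_analyticRank_of_analyticRank_le_one)
    (hmod : hasEntireLFunction_rat) (hMilneC : Milne1972.bsdQuotient_baseChange_quadratic_anyModel)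
    (hr : W.analyticRank = 1) (hT2 : ∀ P : W.toAffine.Point, 2 • P = 0 → P = 0)
    (hK : IsImaginaryQuadratic K) (hodd : Odd (NumberField.discr K)) (h3 : NumberField.discr K ≠ -3)
    (hH : SatisfiesHeegnerHypothesis (W.conductorNorm ℤ) K)
    (Dt : ModularParametrizationData W (W.conductorNorm ℤ)) (hc0 : Dt.c ≠ 0) (β : ℤ) (ι : K →+* ℂ)
    (d₁ : KolyvaginHeegnerData Dt β ι 1) (hy : ¬ IsOfFinAddOrder d₁.derivedPoint) {M₀ : ℕ}
    (hdiv : ∃ Q : (W.baseChange (ringClassField K ι 1)).toAffine.Point, ((2 ^ M₀ : ℕ) : ℤ) • Q = d₁.derivedPoint)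
    (hndiv : ¬ ∃ Q : (W.baseChange (ringClassField K ι 1)).toAffine.Point, ((2 ^ (M₀ + 1) : ℕ) : ℤ) • Q = d₁.derivedPoint)
    (Wd : WeierstrassCurve ℚ) [Wd.IsElliptic] [Wd.IsGloballyMinimal]
    (hWd : ∃ C : VariableChange ℚ, C • W.quadraticTwist (NumberField.discr K : ℚ) = Wd)
    (hBW : BSDp W 2) (hBd : BSDp Wd 2) :
    Nat.card (AddCommGroup.primaryComponent (W.baseChange K).sha 2) *
        2 ^ (2 * (padicValInt 2 Dt.c + padicValNat 2 W.tamagawaProduct)) = 2 ^ (2 * M₀) := by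
  haveI : Fact (Nat.Prime 2) := ⟨Nat.prime_two⟩
  haveI hEK : (W.baseChange K).IsElliptic := isElliptic_baseChange' W K
  have h2 : Module.finrank ℚ K = 2 := hK.1
  obtain ⟨Cd, hCd⟩ := hWd
  obtain ⟨hrd, -, hShaK, q, hshaC, hval⟩ := padicValRat_shaAnOverC_of_swappedPair_noTwoTorsion W K hGZ hGZK hmod
    hr hT2 hK hodd h3 hH Dt hc0 β ι d₁ hy hdiv hndiv Wd Cd hCd
  haveI : Finite (W.baseChange K).sha := hShaK
  obtain ⟨q', hq', hv'⟩ :=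
    (missingPPartOverCAt_baseChange_iff_bsdp W 2 K Wd hGZK hmod hMilneC (by rw [hr]) h2 ⟨Cd, hCd⟩
      (by rw [hrd]; exact zero_le_one) hBd).mpr hBW
  have hqq : q' = q := Rat.cast_injective (α := ℂ) (hq'.symm.trans hshaC)
  rw [hqq, hval, X11b.Three.Koly.padicValNat_shaOrder_eq (W.baseChange K) 2] at hv'
  obtain ⟨k, hk⟩ := X11b.SelmerCount.exists_natCard_primaryComponent_eq_pow_of_finite 2 (G := (W.baseChange K).sha)
  rw [hk, padicValNat.prime_pow] at hv'
  have hk' : (k : ℤ) = 2 * (M₀ : ℤ) - 2 * (padicValInt 2 Dt.c : ℤ) - 2 * (padicValNat 2 W.tamagawaProduct : ℤ) := by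
    exact_mod_cast hv'.symm
  have hkeq : k + 2 * (padicValInt 2 Dt.c + padicValNat 2 W.tamagawaProduct) = 2 * M₀ := by omega
  rw [hk, ← pow_add, hkeq]

/-! ## §4 BSD₂ for EVERY non-CM rank-one curve without rational 2-torsion ⟸ WALL row 1 + Friedberg–Hoffstein + KEX⁰ + PRINT -/

/-- ★ **THE RANK-ONE HALF OF THE LEAF MINUS ITS TORSION CELL, FROM THE WALL, FRIEDBERG–HOFFSTEIN AND ONE KOLYVAGIN STATEMENT.**  Hypotheses: the PRINT
facts (`hGZ`, `hGZK`, `hmod`, `hMilneC`, `hMP`) + Friedberg–Hoffstein `hFH`; `hS1` = S1′ = BSD₂ for every non-CM globally minimal curve of analytic rank `0`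
(= WALL row 1, no Selmer clause); `hKEX0` = KEX⁰ := KEX′ of LINE 23 v2.4/v2.5 with the binder `#Sel₂(W) = 2` REPLACED by `W(ℚ)[2] = 0`.
CONCLUSION: `BSD₂(W)` for EVERY non-CM globally minimal `W` with `r_an = 1` and `W(ℚ)[2] = 0` — i.e. U₂'s cell AND the Ш-cell of the residual R′
(`Ш(W)[2] ≠ 0`, `#Sel₂(W) ≥ 8`).  Proof = g27's §4 verbatim with §2 above in place of its §2.  CONDITIONAL on the displayed hypotheses; proves nothing
about BSD; closes nothing.  [cite: FriedbergHoffstein1995, main theorem] [cite: GrossZagier1986, V.§2 (2.2)] [cite: SilvermanAEC2009, VIII.8 Cor. 8.3]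
[cite: BCDTJAMS2001, Thm. A] [cite: Milne1972ArithmeticAV, §1 Thm. 1] -/
theorem bsdp_of_wall_of_friedbergHoffstein_of_kex0_of_facts
    (hGZ : ∀ (N : ℕ) [NeZero N] (W : WeierstrassCurve ℚ) (K : Type) [Field K] [NumberField K], gross_zagier N W K)
    (hGZK : rank_eq_analyticRank_of_analyticRank_le_one) (hmod : hasEntireLFunction_rat)
    (hMilneC : Milne1972.bsdQuotient_baseChange_quadratic_anyModel) (hMP : nonempty_modularParametrizationData)
    (hFH : friedbergHoffstein_exists_heegnerField_split_twist_ne_zero)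
    (hS1 : ∀ (W : WeierstrassCurve ℚ) [W.IsElliptic] [W.IsGloballyMinimal], ¬ W.HasCM → W.analyticRank = 0 → BSDp W 2)
    (hKEX0 : ∀ (W : WeierstrassCurve ℚ) [W.IsElliptic] [W.IsGloballyMinimal] [NeZero (W.conductorNorm ℤ)],
      ¬ W.HasCM → W.analyticRank = 1 → (∀ P : W.toAffine.Point, 2 • P = 0 → P = 0) →
      ∀ (K : Type) [Field K] [NumberField K], IsImaginaryQuadratic K →
        Odd (NumberField.discr K) → NumberField.discr K ≠ -3 → SatisfiesHeegnerHypothesis (W.conductorNorm ℤ) K →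
        ((Ideal.span {(2 : ℤ)}).primesOver (𝓞 K)).ncard = 2 →
        ∀ (Wd : WeierstrassCurve ℚ) [Wd.IsElliptic] [Wd.IsGloballyMinimal],
          (∃ C : VariableChange ℚ, C • W.quadraticTwist (NumberField.discr K : ℚ) = Wd) →
        (W.quadraticTwist (NumberField.discr K : ℚ)).entireLFunction 1 ≠ 0 →
        ∀ (Dt : ModularParametrizationData W (W.conductorNorm ℤ)) (β : ℤ) (ι : K →+* ℂ) (d₁ : KolyvaginHeegnerData Dt β ι 1),
          ∃ M₀ : ℕ,
            (∃ Q : (W.baseChange (ringClassField K ι 1)).toAffine.Point, ((2 ^ M₀ : ℕ) : ℤ) • Q = d₁.derivedPoint) ∧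
            (¬ ∃ Q : (W.baseChange (ringClassField K ι 1)).toAffine.Point, ((2 ^ (M₀ + 1) : ℕ) : ℤ) • Q = d₁.derivedPoint) ∧
            Nat.card (AddCommGroup.primaryComponent (W.baseChange K).sha 2) *
                2 ^ (2 * (padicValInt 2 Dt.c + padicValNat 2 W.tamagawaProduct)) = 2 ^ (2 * M₀)) :
    ∀ (W : WeierstrassCurve ℚ) [W.IsElliptic] [W.IsGloballyMinimal], ¬ W.HasCM → W.analyticRank = 1 →
      (∀ P : W.toAffine.Point, 2 • P = 0 → P = 0) → BSDp W 2 := by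
  intro W _ _ hcm hr hT2
  haveI : NeZero (W.conductorNorm ℤ) := ⟨(W.conductorNorm_pos_holds).ne'⟩
  -- the sign of the functional equation: `w(W) = −1` from `r_an(W) = 1`
  obtain ⟨Dt₀⟩ := hMP W
  have hw : W.rootNumber = -1 := by
    rcases Literature.NumberTheory.EllipticCurves.rootNumber_eq_one_or_eq_neg_one W with h1 | h1
    · exfalso
      have hev : Even W.analyticRank :=
        (Literature.Barriers.BirchSwinnertonDyer.even_analyticRank_iff_of_isNewformOf_conductorLevel Dt₀.isNewformOf).mpr h1
      rw [hr] at hev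
      exact Nat.not_even_one hev
    · exact h1
  -- Friedberg–Hoffstein: an imaginary quadratic Heegner field with `2` split, `|d_K| > 4` and `L(W^{(d_K)},1) ≠ 0`
  obtain ⟨K, _, _, hK, hB, hH, h2H, hL⟩ := hFH W hw 2 Nat.prime_two 4
  have h2 : Module.finrank ℚ K = 2 := hK.1
  have h2K : ((Ideal.span {(2 : ℤ)}).primesOver (𝓞 K)).ncard = 2 := by
    simpa using h2H 2 Nat.prime_two (dvd_refl 2)
  have hodd : Odd (NumberField.discr K) := by
    have h8 := (ncard_primesOver_two_eq_two_iff (K := K) h2).mp h2K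
    rw [Int.odd_iff]; omega
  have h3 : NumberField.discr K ≠ -3 := by
    intro h; rw [h] at hB; simp at hB
  -- a globally minimal model of the twist
  have hD0 : (NumberField.discr K : ℚ) ≠ 0 := by exact_mod_cast NumberField.discr_ne_zero K
  haveI := W.isElliptic_quadraticTwist hD0
  obtain ⟨Cd, hmin⟩ := hasGlobalMinimalModel_rat_holds (W.quadraticTwist (NumberField.discr K : ℚ))
  haveI := hmin
  -- a conductor-1 datum and its Heegner point of infinite order
  obtain ⟨Dt, β, ι, d₁, hc0⟩ := exists_kolyvaginHeegnerData_one_of_nonempty_modularParametrizationData hMP W K hK hH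
  have hy : ¬ IsOfFinAddOrder d₁.derivedPoint :=
    not_isOfFinAddOrder_derivedPoint_one_of_rankOne_of_lValue_ne_zero hmod W K (hGZ _ W K) hK hH hr hL d₁
  -- KEX⁰: the exact depth and the index relation
  obtain ⟨M₀, hdiv, hndiv, hsha⟩ :=
    hKEX0 W hcm hr hT2 K hK hodd h3 hH h2K (Cd • W.quadraticTwist (NumberField.discr K : ℚ)) ⟨Cd, rfl⟩ hL Dt β ι d₁
  -- the twin is non-CM of analytic rank 0: `BSD₂(Wd)` from the wall
  have hcmd : ¬ (Cd • W.quadraticTwist (NumberField.discr K : ℚ)).HasCM := by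
    rw [hasCM_iff_of_j_eq (((W.quadraticTwist (NumberField.discr K : ℚ)).variableChange_j Cd).trans (W.j_quadraticTwist hD0))]
    exact hcm
  have hrd : (Cd • W.quadraticTwist (NumberField.discr K : ℚ)).analyticRank = 0 := by
    rw [analyticRank_smul]
    exact ((W.quadraticTwist (NumberField.discr K : ℚ)).analyticRank_eq_zero_iff_holds (hmod _)).mpr hL
  have hBd : BSDp (Cd • W.quadraticTwist (NumberField.discr K : ℚ)) 2 := hS1 _ hcmd hrd
  exact swappedPairDescentAtTwo_shaDepth_noTwoTorsion_of_facts hGZ hGZK hmod hMilneC W hr hT2 K hK hodd h3 hH Dt hc0 β ι d₁ hy M₀ hdiv hndiv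
    hsha (Cd • W.quadraticTwist (NumberField.discr K : ℚ)) ⟨Cd, rfl⟩ hBd

/-! ## §5 Losslessness: (BSD₂ on rank one without 2-torsion) + WALL row 1 + PRINT ⟹ KEX⁰ -/

/-- ★ **KEX⁰ IS LOSSLESS**: BSD₂ for every non-CM rank-one `W` with `W(ℚ)[2] = 0` (the CONCLUSION of §4) + S1′ + PRINT ⟹ KEX⁰ (the research hypothesis of
§4, text VERBATIM; Friedberg–Hoffstein is not needed in this direction).  So modulo WALL row 1 + PRINT, KEX⁰ is EQUIVALENT to «BSD₂ on the rank-one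
non-CM curves without rational `2`-torsion» = U₂ ∧ (Ш-cell of R′).  CONDITIONAL; proves nothing about BSD; closes nothing.
[cite: GrossZagier1986, V.§2 (2.2)] [cite: Milne1972ArithmeticAV, §1 Thm. 1] [cite: SilvermanAEC2009, Thm. VIII.6.7] -/
theorem kex0_of_rankOneNoTwoTorsionBSDTwo_of_wall_of_facts
    (hGZ : ∀ (N : ℕ) [NeZero N] (W : WeierstrassCurve ℚ) (K : Type) [Field K] [NumberField K], gross_zagier N W K)
    (hGZK : rank_eq_analyticRank_of_analyticRank_le_one) (hmod : hasEntireLFunction_rat)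
    (hMilneC : Milne1972.bsdQuotient_baseChange_quadratic_anyModel)
    (hS1 : ∀ (W : WeierstrassCurve ℚ) [W.IsElliptic] [W.IsGloballyMinimal], ¬ W.HasCM → W.analyticRank = 0 → BSDp W 2)
    (hR1 : ∀ (W : WeierstrassCurve ℚ) [W.IsElliptic] [W.IsGloballyMinimal],
      ¬ W.HasCM → W.analyticRank = 1 → (∀ P : W.toAffine.Point, 2 • P = 0 → P = 0) → BSDp W 2) :
    ∀ (W : WeierstrassCurve ℚ) [W.IsElliptic] [W.IsGloballyMinimal] [NeZero (W.conductorNorm ℤ)],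
      ¬ W.HasCM → W.analyticRank = 1 → (∀ P : W.toAffine.Point, 2 • P = 0 → P = 0) →
      ∀ (K : Type) [Field K] [NumberField K], IsImaginaryQuadratic K →
        Odd (NumberField.discr K) → NumberField.discr K ≠ -3 → SatisfiesHeegnerHypothesis (W.conductorNorm ℤ) K →
        ((Ideal.span {(2 : ℤ)}).primesOver (𝓞 K)).ncard = 2 →
        ∀ (Wd : WeierstrassCurve ℚ) [Wd.IsElliptic] [Wd.IsGloballyMinimal],
          (∃ C : VariableChange ℚ, C • W.quadraticTwist (NumberField.discr K : ℚ) = Wd) →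
        (W.quadraticTwist (NumberField.discr K : ℚ)).entireLFunction 1 ≠ 0 →
        ∀ (Dt : ModularParametrizationData W (W.conductorNorm ℤ)) (β : ℤ) (ι : K →+* ℂ) (d₁ : KolyvaginHeegnerData Dt β ι 1),
          ∃ M₀ : ℕ,
            (∃ Q : (W.baseChange (ringClassField K ι 1)).toAffine.Point, ((2 ^ M₀ : ℕ) : ℤ) • Q = d₁.derivedPoint) ∧
            (¬ ∃ Q : (W.baseChange (ringClassField K ι 1)).toAffine.Point, ((2 ^ (M₀ + 1) : ℕ) : ℤ) • Q = d₁.derivedPoint) ∧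
            Nat.card (AddCommGroup.primaryComponent (W.baseChange K).sha 2) *
                2 ^ (2 * (padicValInt 2 Dt.c + padicValNat 2 W.tamagawaProduct)) = 2 ^ (2 * M₀) := by
  intro W _ _ _ hcm hr hT2 K _ _ hK hodd h3 hH _h2K Wd _ _ hWd hL Dt β ι d₁
  obtain ⟨Cd, hCd⟩ := hWd
  have hD0 : (NumberField.discr K : ℚ) ≠ 0 := by exact_mod_cast NumberField.discr_ne_zero K
  haveI := W.isElliptic_quadraticTwist hD0
  have hcmd : ¬ Wd.HasCM := by
    rw [← hCd, hasCM_iff_of_j_eq (((W.quadraticTwist (NumberField.discr K : ℚ)).variableChange_j Cd).trans (W.j_quadraticTwist hD0))]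
    exact hcm
  have hrd : Wd.analyticRank = 0 := by
    rw [← hCd, analyticRank_smul]
    exact ((W.quadraticTwist (NumberField.discr K : ℚ)).analyticRank_eq_zero_iff_holds (hmod _)).mpr hL
  have hy : ¬ IsOfFinAddOrder d₁.derivedPoint :=
    not_isOfFinAddOrder_derivedPoint_one_of_rankOne_of_lValue_ne_zero hmod W K (hGZ _ W K) hK hH hr hL d₁
  haveI := (finiteDimensional_and_isGalois_ringClassField hK ι one_ne_zero).1
  haveI : NumberField (ringClassField K ι 1) := NumberField.of_module_finite K _
  haveI : (W.baseChange (ringClassField K ι 1)).IsElliptic := by rw [baseChange]; infer_instance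
  haveI : Module.Finite ℤ (W.baseChange (ringClassField K ι 1)).toAffine.Point := by
    convert (W.baseChange (ringClassField K ι 1)).module_finite_point_holds
  obtain ⟨M₀, hdiv, hndiv⟩ := exists_exactTwoDepth
    (A := (W.baseChange (ringClassField K ι 1)).toAffine.Point) (y := d₁.derivedPoint) (by convert hy)
  have hc0 : Dt.c ≠ 0 := fun h ↦ Dt.cast_c_ne_zero (by rw [h, Int.cast_zero])
  exact ⟨M₀, hdiv, hndiv, natCard_sha_mul_eq_of_bsdp_noTwoTorsion W K (hGZ _ W K) hGZK hmod hMilneC hr hT2 hK hodd h3 hH Dt hc0 β ι d₁ hy hdiv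
    hndiv Wd ⟨Cd, hCd⟩ (hR1 W hcm hr hT2) (hS1 Wd hcmd hrd)⟩

end Summit.BirchSwinnertonDyer.BirchSwinnertonDyer.Theorems.GenusExact.TwinSwap.AnalyticTwin.NoTwoTorsion

end
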